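import Summits.BirchSwinnertonDyer.BirchSwinnertonDyer.Theorems.QuadraticBranchSignedControlPlusEtaNonsurjConjADoorBSDRankOne
import Summits.BirchSwinnertonDyer.Rank1Residual.X11b.KrausMinimalityGeneralTwo
import Summits.BirchSwinnertonDyer.BirchSwinnertonDyer.Theorems.QuadraticBranchSignedControlPlusEtaNonsurjConjADoorUnitRecordsD
import HarnessLib

/-!
# Route `QuadraticBranchSignedControl` (rung K8, cell `bsd-potss`), residual crux `PlusEtaMainConjectureNonsurj`
# (stmt-BirchSwinnertonDyer-19606): UNCONGRUENT `BSD_5` RECORDS D — `MissingPPartAt W 5` (ord₅ #Ш = ord₅ #Ш_an) on members of the uncongruent family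
# u5a newly resolved by the long run (kit j330280; seat `bsd-potss-k8eta-c2` g22): unit rows modulo named published facts only, rank-one rows modulo
# the route's declared residual C-cc-1 AT THE ROW

WHAT. Rows of this file: u5a:76 (unit) (`5`-partners `W_D` of `A^{(D)}`, `A = [1,−1,1,−4010,98676]`, Zywina's `X_ns⁺(5)` `t = 4/5`; UNCONGRUENT class).
UNIT rows: `EtaConjADoorUnitBSD.missingPPartAt_of_{relClassNumber,eigenHom}_of_isUnit` (p717939: door ⟹ (A)(W,5) ⟹ unit-row door ⟹ (C1⁺_η)(V) ⟹
η→F seam ⟹ exact even control; named facts `hGZK hmod hnf hM h12 hKO h22 h41 h6273`, Poitou–Tate and the plus transport tree theorems). Rank-ONE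
rows: `EtaConjADoorBSDRankOne.bsdp_r1_of_{relClassNumber,eigenHom}` (p718742: + `hGZ h74` + `QuadraticBranchMinusLeadingValuationAt W 5 0` displayed —
the crux C-cc-1 at this row, OPEN, not certified). Kernel: global minimality of each `W` (Kraus/Silverman support certificate, `decide`).

HONEST FRAMING (cell `bsd-potss`; FULL-BSD rank ≤ 1 programme, HUMAN RULING D-0036/D-0074): per-row RECORDS, CONDITIONAL as displayed; `BSD(W,5)`
ASSERTED for no pair; no stub of 19606 proved; crux and route OPEN; nothing booked. `--supports stmt-BirchSwinnertonDyer-19606`.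

References: [Kobayashi2003] Thm. 1.2, 2.2, §4, Thm. 4.1, 6.2–7.4, 9.3; [KitajimaOtsuki2018] Main Thm. 1.3; [Mazur1978] Cor. 4.1; [Miller2011LMS] Def. 1.1;
[GrossZagier1986] I (7.3); [CoatesSujatha2005] §3 (A); [SilvermanAEC2009] VII.1 Rem. 1.1; [Zywina2015] Thm. 1.4.
-/

set_option autoImplicit false
set_option linter.dupNamespace false
noncomputable section

open scoped Classical nonZeroDivisors

open CongruenceSubgroup NumberField Field WeierstrassCurve
open Literature.NumberTheory.EllipticCurves Literature.NumberTheory.EllipticCurves.ModularForms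
  Literature.NumberTheory.EllipticCurves.Rank1Residual Literature.NumberTheory.EllipticCurves.Rank1Residual.Typed
  Literature.NumberTheory.GaloisRepresentations Literature.NumberTheory.GaloisCohomology Literature.NumberTheory.NumberFields
  Literature.NumberTheory.EllipticCurves.GreenbergVatsal2000 ZpExtension
open Summit.BirchSwinnertonDyer.Rank1Residual Summit.BirchSwinnertonDyer.Rank1Residual.Additive
open Summit.BirchSwinnertonDyer.Rank1Residual.X11b (isElliptic_of_discOf_ne_zero)
open Summit.BirchSwinnertonDyer.BirchSwinnertonDyer.Theorems
open Summit.BirchSwinnertonDyer.Rank1Residual.X11b (isGloballyMinimal_of_krausCriterion_support)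

namespace Summit.BirchSwinnertonDyer.BirchSwinnertonDyer.Theorems.EtaConjADoorUnitBSDRecords

set_option maxRecDepth 100000 in
/-- `W = [0, 0, 0, -578998875, 5359559154250]` is a global minimal equation (Silverman VII.1 Rem. 1.1 on the support `|Δ| = 2^12 · 3^4 · 5^6 · 7^3 ·
11^5 · 19^6` — at every prime `q` of the support `q¹² ∤ Δ` or `q⁴ ∤ c₄`, or Kraus's test at `2`; tree `isGloballyMinimal_of_krausCriterion_support`,
kernel `decide`). [cite: SilvermanAEC2009, VII.1 Remark 1.1] [cite: Kraus1989, Prop. 1 and Prop. 2] -/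
theorem isGloballyMinimal_u5a_76 : (⟨0, 0, 0, (-578998875), 5359559154250⟩ : WeierstrassCurve ℚ).IsGloballyMinimal :=
  isGloballyMinimal_of_krausCriterion_support 0 0 0 (-578998875) 5359559154250 [(2, 0, 12), (3, 0, 4), (5, 0, 6), (7, 0, 3), (11, 0, 5), (19, 0, 6)]
    (by
      intro t ht
      simp only [List.mem_cons, List.not_mem_nil, or_false] at ht
      rcases ht with rfl | rfl | rfl | rfl | rfl | rfl <;> norm_num)
    (by decide +kernel) (by decide +kernel)

/-- **`MissingPPartAt W 5` — `ord_5 #Ш(W) = ord_5 #Ш_an(W)`, the `5`-part of `BSD(W,5)` — for the UNCONGRUENT UNIT partner u5a:76, granted ONE good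
`a_5 = 0` globally minimal model `V` of `W^{(5)}` with non-onto `5`-adic tower** (`W = [0, 0, 0, -578998875, 5359559154250]`, non-CM, `N_W =
6304359600`; kit j330280 (4763 s, GRH): `ε(W) = +1`, PARI plus-`η` `(λ, μ) = (0, 0)` — `L_5⁺(V,η,T)` is a UNIT of `Λ` —, `r_an(W) = 0` (`unit
certificate (lambda+,mu+)=(0,0) => L(W,1)!=0 by (3.6); ellanalyticrank infeasible at N_W=6.3e9 (j334001/j334005 stack)`); `h(ℚ(P)) = 960`
(`[60,2,2,2,2]`), `h(ℚ(x(P))) = 15`; eigen dimensions `(d₁,d₂,d₃,d₄) = (0,0,0,1)` — door L6⁻ (relative class number) passes) from the ROW ALONE —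
named facts `hGZK hmod hnf hM h12 hKO h22 h41 h6273` (GZK, modularity, newforms, Mazur `p ∤ c₀`, Kobayashi Thm. 1.2 / 2.2 / 4.1 / 6.2–7.3,
Kitajima–Otsuki Thm. 1.3; Poitou–Tate and the plus transport are tree theorems); displayed: `r_an(W) = 0`, the twin `V` with the tower clause, the
unit certificate «every `L_5⁺(V,η,T)` is a unit», the class-group datum. Instance of
`EtaConjADoorUnitBSD.missingPPartAt_of_relClassNumber_of_isUnit` (k8eta-c2 g22). CONDITIONAL; nothing booked. [cite: Kobayashi2003, §4 (p. 8), Thm.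
2.2 (p. 5)] [cite: CoatesSujatha2005, §3 (A) and Thm. 3.4] [cite: Zywina2015, Thm. 1.4] -/
theorem missingPPartAt_u5a_76_5_of_relClassNumber
    (hGZK : rank_eq_analyticRank_of_analyticRank_le_one) (hmod : hasEntireLFunction_rat)
    (hnf : exists_isNewformOf) (hM : mazur_not_dvd_maninConstant_of_odd)
    (h12 : Kobayashi2003.thm12_signedSelmerDual_finite_torsion)
    (hKO : KitajimaOtsuki2018.mainThm13_etaSignedSelmerDual_noFiniteSubmodule)
    (h22 : Kobayashi2003.thm22_etaSignedSelmerDual_finite_torsion)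
    (h41 : Kobayashi2003.thm41_plusEtaCharIdeal_dvd)
    (h6273 : Kobayashi2003.thm62_63_73_etaColemanPoitouTate) [Fact (5 : ℕ).Prime]
    (W : WeierstrassCurve ℚ) (hW : W = (⟨0, 0, 0, (-578998875), 5359559154250⟩ : WeierstrassCurve ℚ))
    (V : WeierstrassCurve ℚ) [V.IsElliptic] [V.IsGloballyMinimal] (C : VariableChange ℚ)
    (hC : C • W.quadraticTwist 5 = V)
    (hgood : V.HasGoodReductionAtPrime 5) (hap : V.frobeniusTrace 5 = 0)
    (hns : ¬ ∀ m : ℕ, V.HasSurjectiveModNGaloisRep (5 ^ m : ℕ))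
    (hunit : ∀ {N : ℕ} [NeZero N] {f : CuspForm (Gamma0 N) 2}, IsNewformOf V f →
      ∀ (ϖ : ℚ), (if Even (5 / 2) then (ϖ : ℝ) * V.realPeriodRat = plusPeriod f
          else (ϖ : ℝ) * V.imaginaryPeriodRat = minusPeriod f) →
      ∀ (Lη : IwasawaAlgebra 5), IsQuadraticBranchPlusLFunction f 5 ϖ Lη → IsUnit Lη)
    (hP : haveI : W.IsElliptic := hW ▸ Summit.BirchSwinnertonDyer.BirchSwinnertonDyer.Theorems.EtaConjADoorUnitRecords.isElliptic_u5a_76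
      haveI : NeZero (5 : ℕ) := ⟨by norm_num⟩
      haveI : NumberField (W.divisionField 5) := NumberField.mk
      ∃ P : geomTorsion W ((5 : ℕ) : ℤ), P ≠ 0 ∧ ∀ τ : absoluteGaloisGroup ℚ, τ • P = -P →
        ∀ K : IntermediateField ℚ (W.divisionField 5),
          K = IntermediateField.fixedField
            ((MulAction.stabilizer (absoluteGaloisGroup ℚ) P).map (absRestrictNormalHom (W.divisionField 5))) →
        ∀ σ : K ≃ₐ[ℚ] K,
          (∀ x : K, absRestrictNormalHom (W.divisionField 5) τ (x : W.divisionField 5) =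
            ((σ x : K) : W.divisionField 5)) →
          padicValNat 5 (NumberField.classNumber K) ≤
            padicValNat 5 (NumberField.classNumber (IntermediateField.fixedField (Subgroup.zpowers σ)))) (hr0 : W.analyticRank = 0) :
    MissingPPartAt W 5 := by
  subst hW
  haveI : (⟨0, 0, 0, (-578998875), 5359559154250⟩ : WeierstrassCurve ℚ).IsElliptic := Summit.BirchSwinnertonDyer.BirchSwinnertonDyer.Theorems.EtaConjADoorUnitRecords.isElliptic_u5a_76
  haveI : (⟨0, 0, 0, (-578998875), 5359559154250⟩ : WeierstrassCurve ℚ).IsGloballyMinimal := isGloballyMinimal_u5a_76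
  haveI : NeZero (5 : ℕ) := ⟨by norm_num⟩
  exact EtaConjADoorUnitBSD.missingPPartAt_of_relClassNumber_of_isUnit _ 5 hGZK hmod hnf hM h12 hKO h22 h41 h6273 (le_refl 5) V C
    (by rw [show ((-1 : ℚ) ^ ((5 : ℕ) / 2) * ((5 : ℕ) : ℚ)) = 5 by norm_num]; exact hC) hgood hap hns hP hunit hr0

end Summit.BirchSwinnertonDyer.BirchSwinnertonDyer.Theorems.EtaConjADoorUnitBSDRecords

end
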